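import Mathlib
import Literature.Analysis.FluidPDE.VectorCalculus

/-!
# `SkeletonEquilibrium` (stmt-NavierStokesRegularity-15400): axial helices are never filaments of a relative equilibrium on their own

Negative-side structural helper for the (held) support item `FilamentSkeletonRss.SkeletonEquilibrium`
(`--supports stmt-NavierStokesRegularity-15400`). The earlier leaf hands' no-coiling census for the shared
a-priori stub `stub_lengthRegular` records the heuristic «uniform solenoids leave the radial `½a` Leray drift
unbalanced — no witness, no exclusion» (leafhand-18, 2026-08-31). This file turns the heuristic into a
kernel-checked EXCLUSION for the exactly symmetric class:

* `inner_single_zero_integral_helix_eq_zero` — for the circular helix / solenoid about the rotation axis,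
  `Ξ(σ) = (a cos ωσ, a sin ωσ, z₀ + pσ)` (ANY radius `a`, pitch `p`, angular rate `ω`, height `z₀`; this
  class contains the off-axis vertical lines `ω = 0` and the horizontal circles `p = 0`), the regularised
  Biot–Savart self-induction of the crux, `∫ ((‖Ξ 0 − Ξ σ‖² + 1)^{3/2})⁻¹ • Ξ′(σ) × (Ξ 0 − Ξ σ) dσ`, has ZERO
  radial component at the point `Ξ 0 = (a, 0, z₀)`: the radial component of the integrand is the odd
  function `σ ↦ K(σ) · a p (sin ωσ − ωσ cos ωσ)` with `K` even (the `π`-rotation about the radial line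
  through the point maps the helix to itself reversing its orientation). No integrability hypothesis is
  needed (a non-integrable integrand has Bochner integral `0`).
* `helix_not_tangent` — hence the relative-equilibrium identity of the crux,
  `c • (self-induction) + ½ Ξ − α e₃ × Ξ = w Ξ′`, FAILS at `Ξ 0` for every coefficient `c`, every angular
  speed `α` and every slip value `w`, as soon as `a ≠ 0`: its radial component reads `a/2 = 0` (the frame
  rotation `e₃ × Ξ 0 = a e₂` and the tangent `Ξ′ 0 = (0, aω, p)` are both orthogonal to the radial direction).
* `no_single_helix_equilibrium` — the `N = 1` tangency clause of `SkeletonEquilibrium` VERBATIM (sum over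
  `Fin 1`, coefficient `Γγ₀/4π`, `EuclideanSpace.single 2 1`) has no solution whose filament is such a helix,
  whatever `Γ, γ, α, w` (so a single filament in relative equilibrium is never an axial solenoid, circle or
  off-axis vertical line; the axis itself, `a = 0`, IS an equilibrium).
* `radial_balance_of_helical_strand` — for general `N`: if filament `j` of a configuration satisfying the
  tangency clause at `(j, τ = 0)` is such a helix, the partner filaments must induce at `Ξ_j 0` an INWARD
  radial velocity of size exactly `a/2` (the self term drops out), i.e.
  `Σ_k ⟪e₀, (Γγ_k/4π) • ∫ …⟫ = −a/2`; with the landed velocity bound `‖u‖ ≤ √Γ Σ|γ|/(2πρ)` of the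
  straight-class files this confines exact axial helical strands to radii `a = O(√Γ/ρ)`.

The evaluation point is normalised to parameter `0` and phase `0`; a general helical strand about the axis is
brought to this form by the parameter shift `σ ↦ σ − τ₀` and a rotation about `e₃` (both leave the clause
invariant), so nothing is lost. Def-free: the helix enters through the hypothesis `hΞ : Ξ = fun σ => …`.
Mathlib + `Literature.Analysis.FluidPDE.VectorCalculus` (`cross`) only; no route file is imported.
-/

-- `NavierStokesRegularity.NavierStokesRegularity` is the summit/problem path (D-0017), flagged by dupNamespace.
set_option linter.dupNamespace false

namespace Summit.NavierStokesRegularity.NavierStokesRegularity.Theorems.SkeletonEquilibrium.HelixExclusion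

open Literature.Analysis.FluidPDE MeasureTheory Real
open scoped RealInnerProductSpace InnerProductSpace BigOperators

/-- Radial (`0`-th) component of the cross product `v × w`. [folklore] -/
private theorem cross_apply_zero (v w : EuclideanSpace ℝ (Fin 3)) :
    cross v w 0 = v 1 * w 2 - v 2 * w 1 := by
  simp [cross, cross_apply]

/-- `⟪e₀, v⟫ = v 0`. [folklore] -/
private theorem inner_single_zero_left (v : EuclideanSpace ℝ (Fin 3)) :
    ⟪EuclideanSpace.single (0 : Fin 3) (1 : ℝ), v⟫ = v 0 := by
  rw [EuclideanSpace.inner_single_left]; simp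

/-- Components of `e₂ = EuclideanSpace.single 2 1`: `e₂ 1 = 0`. [folklore] -/
private theorem single_two_apply_one : (EuclideanSpace.single (2 : Fin 3) (1 : ℝ)) 1 = 0 := by simp

/-- Components of `e₂ = EuclideanSpace.single 2 1`: `e₂ 2 = 1`. [folklore] -/
private theorem single_two_apply_two : (EuclideanSpace.single (2 : Fin 3) (1 : ℝ)) 2 = 1 := by simp

/-- The integral of an odd real function over `ℝ` vanishes (no integrability needed). [folklore] -/
private theorem integral_eq_zero_of_odd (h : ℝ → ℝ) (hodd : ∀ σ, h (-σ) = -h σ) :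
    ∫ σ, h σ = 0 := by
  have h1 : ∫ σ, h (-σ) = ∫ σ, h σ := integral_neg_eq_self h volume
  simp_rw [hodd, integral_neg] at h1
  linarith

section Helix

variable {a ω p z₀ : ℝ} {Ξ : ℝ → EuclideanSpace ℝ (Fin 3)}
  (hΞ : Ξ = fun σ => (a * Real.cos (ω * σ)) • EuclideanSpace.single (0 : Fin 3) (1 : ℝ) +
    (a * Real.sin (ω * σ)) • EuclideanSpace.single (1 : Fin 3) (1 : ℝ) +
    (z₀ + p * σ) • EuclideanSpace.single (2 : Fin 3) (1 : ℝ))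
include hΞ

/-- Coordinates of the helix. [folklore] -/
theorem helix_apply (σ : ℝ) :
    Ξ σ 0 = a * Real.cos (ω * σ) ∧ Ξ σ 1 = a * Real.sin (ω * σ) ∧ Ξ σ 2 = z₀ + p * σ := by
  subst hΞ
  refine ⟨?_, ?_, ?_⟩ <;> simp

/-- The velocity of the helix: `Ξ′(σ) = (−aω sin ωσ, aω cos ωσ, p)`. [folklore] -/
theorem hasDerivAt_helix (σ : ℝ) :
    HasDerivAt Ξ ((-(a * ω * Real.sin (ω * σ))) • EuclideanSpace.single (0 : Fin 3) (1 : ℝ) +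
      (a * ω * Real.cos (ω * σ)) • EuclideanSpace.single (1 : Fin 3) (1 : ℝ) +
      p • EuclideanSpace.single (2 : Fin 3) (1 : ℝ)) σ := by
  subst hΞ
  have hl : HasDerivAt (fun x : ℝ => ω * x) (ω * 1) σ := (hasDerivAt_id' σ).const_mul ω
  have h0 := ((hl.cos).const_mul a).smul_const (EuclideanSpace.single (0 : Fin 3) (1 : ℝ))
  have h1 := ((hl.sin).const_mul a).smul_const (EuclideanSpace.single (1 : Fin 3) (1 : ℝ))
  have h2 := (((hasDerivAt_id' σ).const_mul p).const_add z₀).smul_const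
    (EuclideanSpace.single (2 : Fin 3) (1 : ℝ))
  have h := (h0.add h1).add h2
  refine h.congr_deriv ?_
  simp only [mul_one]
  module

/-- `deriv` form of `hasDerivAt_helix`. [folklore] -/
theorem deriv_helix (σ : ℝ) :
    deriv Ξ σ = (-(a * ω * Real.sin (ω * σ))) • EuclideanSpace.single (0 : Fin 3) (1 : ℝ) +
      (a * ω * Real.cos (ω * σ)) • EuclideanSpace.single (1 : Fin 3) (1 : ℝ) +
      p • EuclideanSpace.single (2 : Fin 3) (1 : ℝ) :=
  (hasDerivAt_helix hΞ σ).deriv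

/-- Coordinates of the velocity of the helix. [folklore] -/
theorem deriv_helix_apply (σ : ℝ) :
    deriv Ξ σ 0 = -(a * ω * Real.sin (ω * σ)) ∧ deriv Ξ σ 1 = a * ω * Real.cos (ω * σ) ∧
      deriv Ξ σ 2 = p := by
  rw [deriv_helix hΞ σ]
  refine ⟨?_, ?_, ?_⟩ <;> simp

/-- The radial component of the crux's self-induction integrand of the helix at `Ξ 0`:
`⟪e₀, K • Ξ′σ × (Ξ 0 − Ξ σ)⟫ = K · a p (sin ωσ − ωσ cos ωσ)`. [folklore] -/
theorem inner_single_zero_integrand_helix (σ : ℝ) :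
    ⟪EuclideanSpace.single (0 : Fin 3) (1 : ℝ),
      ((‖Ξ 0 - Ξ σ‖ ^ 2 + 1) ^ (3 / 2 : ℝ))⁻¹ • cross (deriv Ξ σ) (Ξ 0 - Ξ σ)⟫ =
      ((‖Ξ 0 - Ξ σ‖ ^ 2 + 1) ^ (3 / 2 : ℝ))⁻¹ *
        (a * p * (Real.sin (ω * σ) - ω * σ * Real.cos (ω * σ))) := by
  obtain ⟨_, h01, h02⟩ := helix_apply hΞ 0
  obtain ⟨_, hσ1, hσ2⟩ := helix_apply hΞ σ
  obtain ⟨_, hd1, hd2⟩ := deriv_helix_apply hΞ σ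
  rw [real_inner_smul_right, inner_single_zero_left, cross_apply_zero]
  simp only [PiLp.sub_apply, h01, h02, hσ1, hσ2, hd1, hd2, mul_zero, Real.sin_zero, add_zero]
  ring

/-- The regularising distance is even in the parameter: `‖Ξ 0 − Ξ(−σ)‖ = ‖Ξ 0 − Ξ σ‖`. [folklore] -/
theorem norm_helix_chord_neg (σ : ℝ) : ‖Ξ 0 - Ξ (-σ)‖ = ‖Ξ 0 - Ξ σ‖ := by
  obtain ⟨h00, h01, h02⟩ := helix_apply hΞ 0
  obtain ⟨hσ0, hσ1, hσ2⟩ := helix_apply hΞ σ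
  obtain ⟨hn0, hn1, hn2⟩ := helix_apply hΞ (-σ)
  rw [EuclideanSpace.norm_eq, EuclideanSpace.norm_eq]
  congr 1
  simp only [Fin.sum_univ_three, PiLp.sub_apply, h00, h01, h02, hσ0, hσ1, hσ2, hn0, hn1, hn2,
    Real.norm_eq_abs, sq_abs, mul_neg, Real.cos_neg, Real.sin_neg, mul_zero, Real.sin_zero,
    Real.cos_zero]
  ring

/-- The radial component of the self-induction integrand is ODD in the parameter. [folklore] -/
theorem inner_single_zero_integrand_helix_odd (σ : ℝ) :
    ⟪EuclideanSpace.single (0 : Fin 3) (1 : ℝ),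
      ((‖Ξ 0 - Ξ (-σ)‖ ^ 2 + 1) ^ (3 / 2 : ℝ))⁻¹ • cross (deriv Ξ (-σ)) (Ξ 0 - Ξ (-σ))⟫ =
      -⟪EuclideanSpace.single (0 : Fin 3) (1 : ℝ),
        ((‖Ξ 0 - Ξ σ‖ ^ 2 + 1) ^ (3 / 2 : ℝ))⁻¹ • cross (deriv Ξ σ) (Ξ 0 - Ξ σ)⟫ := by
  rw [inner_single_zero_integrand_helix hΞ, inner_single_zero_integrand_helix hΞ,
    norm_helix_chord_neg hΞ]
  simp only [mul_neg, Real.sin_neg, Real.cos_neg, neg_mul]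
  ring

/-- **The self-induction of an axial helix has no radial component at the filament.** The regularised
Biot–Savart self-induction of the crux, `∫ ((‖Ξ 0 − Ξ σ‖² + 1)^{3/2})⁻¹ • Ξ′σ × (Ξ 0 − Ξ σ) dσ`, is
orthogonal to the radial direction `e₀` at `Ξ 0 = (a, 0, z₀)` — by oddness of the radial integrand (the
`π`-rotation about the radial line through the point is a symmetry of the helix reversing its orientation);
if the integrand is not integrable the Bochner integral is `0` and the claim holds trivially. [folklore] -/
theorem inner_single_zero_integral_helix_eq_zero :
    ⟪EuclideanSpace.single (0 : Fin 3) (1 : ℝ),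
      ∫ σ : ℝ, ((‖Ξ 0 - Ξ σ‖ ^ 2 + 1) ^ (3 / 2 : ℝ))⁻¹ • cross (deriv Ξ σ) (Ξ 0 - Ξ σ)⟫ = 0 := by
  by_cases hI : Integrable (fun σ : ℝ => ((‖Ξ 0 - Ξ σ‖ ^ 2 + 1) ^ (3 / 2 : ℝ))⁻¹ •
      cross (deriv Ξ σ) (Ξ 0 - Ξ σ))
  · rw [← integral_inner hI]
    exact integral_eq_zero_of_odd _ (inner_single_zero_integrand_helix_odd hΞ)
  · rw [integral_undef hI, inner_zero_right]

/-- **Axial helices are never tangent to the Leray–rotating skeleton field.** For the helix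
`Ξ(σ) = (a cos ωσ, a sin ωσ, z₀ + pσ)` with `a ≠ 0` and ANY coefficient `c` (e.g. `Γγ/4π`), angular speed `α`
and slip value `w`, the relative-equilibrium identity of `SkeletonEquilibrium`,
`c • ∫ ((‖Ξ 0 − Ξ σ‖²+1)^{3/2})⁻¹ • Ξ′σ × (Ξ 0 − Ξ σ) dσ + ½ Ξ 0 − α e₃ × Ξ 0 = w Ξ′ 0`, is false: its
radial component is `a/2 = 0` (self-induction radial-free by `inner_single_zero_integral_helix_eq_zero`,
`e₃ × Ξ 0 = a e₂` and `Ξ′ 0 = (0, aω, p)` radial-free). Covers solenoids of every pitch, horizontal circles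
(`p = 0`) and off-axis vertical lines (`ω = 0`); the axis `a = 0` is a genuine equilibrium. [folklore] -/
theorem helix_not_tangent (ha : a ≠ 0) (c α w : ℝ) :
    c • (∫ σ : ℝ, ((‖Ξ 0 - Ξ σ‖ ^ 2 + 1) ^ (3 / 2 : ℝ))⁻¹ • cross (deriv Ξ σ) (Ξ 0 - Ξ σ)) +
      (1 / 2 : ℝ) • Ξ 0 - α • cross (EuclideanSpace.single (2 : Fin 3) (1 : ℝ)) (Ξ 0) ≠
      w • deriv Ξ 0 := by
  intro h
  have key := congrArg (fun v => ⟪EuclideanSpace.single (0 : Fin 3) (1 : ℝ), v⟫) h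
  obtain ⟨h00, h01, h02⟩ := helix_apply hΞ 0
  obtain ⟨hd0, _, _⟩ := deriv_helix_apply hΞ 0
  simp only [inner_sub_right, inner_add_right, real_inner_smul_right,
    inner_single_zero_integral_helix_eq_zero hΞ, mul_zero, zero_add, inner_single_zero_left,
    cross_apply_zero, single_two_apply_one, single_two_apply_two, h00, h01, hd0, Real.cos_zero,
    Real.sin_zero, mul_one, mul_zero, neg_zero, zero_mul, sub_zero] at key
  apply ha
  linarith

end Helix

/-- **No single-filament relative equilibrium is an axial helix.** The `N = 1` tangency clause of
`FilamentSkeletonRss.SkeletonEquilibrium` VERBATIM (sum over `Fin 1`, coefficients `Γγ_k/4π`, frame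
rotation `α e₃ × ·`) admits no solution `(Ξ, w)` whose filament is a circular helix / solenoid / circle /
off-axis vertical line about the rotation axis (`a ≠ 0`), for any `Γ, γ, α`: evaluate the clause at
`(j, τ) = (0, 0)` and apply `helix_not_tangent`. [folklore] -/
theorem no_single_helix_equilibrium (a ω p z₀ : ℝ) (ha : a ≠ 0)
    (Ξ : Fin 1 → ℝ → EuclideanSpace ℝ (Fin 3))
    (hΞ : Ξ 0 = fun σ => (a * Real.cos (ω * σ)) • EuclideanSpace.single (0 : Fin 3) (1 : ℝ) +
      (a * Real.sin (ω * σ)) • EuclideanSpace.single (1 : Fin 3) (1 : ℝ) +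
      (z₀ + p * σ) • EuclideanSpace.single (2 : Fin 3) (1 : ℝ))
    (γ : Fin 1 → ℝ) (Γ α : ℝ) (w : Fin 1 → ℝ → ℝ) :
    ¬ (∀ (j : Fin 1) (τ : ℝ), (∑ k : Fin 1, (Γ * γ k / (4 * Real.pi)) • ∫ σ : ℝ,
        ((‖Ξ j τ - Ξ k σ‖ ^ 2 + 1) ^ (3 / 2 : ℝ))⁻¹ • cross (deriv (Ξ k) σ) (Ξ j τ - Ξ k σ)) +
        (1 / 2 : ℝ) • Ξ j τ - α • cross (EuclideanSpace.single (2 : Fin 3) (1 : ℝ)) (Ξ j τ) =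
        w j τ • deriv (Ξ j) τ) := by
  intro h
  have h0 := h 0 0
  rw [Fin.sum_univ_one] at h0
  exact helix_not_tangent hΞ ha (Γ * γ 0 / (4 * Real.pi)) α (w 0 0) h0

/-- **Radial balance law for an axial helical strand (general `N`).** If filament `j` of a configuration is
the helix `(a cos ωσ, a sin ωσ, z₀ + pσ)` and the tangency clause of `SkeletonEquilibrium` holds at
`(j, τ = 0)`, then (i) the self term has no radial component there and (ii) the radial components of ALL the
induction terms sum to `−a/2`: the partner filaments must push the strand INWARD at speed exactly `a/2` (the
Leray drift `½ Ξ` is purely outward-radial plus axial on the strand, the rotation and the slip are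
radial-free). Since partner inductions are `O(√Γ/ρ)` (straight-class velocity bounds), exact axial helical
strands can only occur at radii `a = O(√Γ/ρ)`. [folklore] -/
theorem radial_balance_of_helical_strand {N : ℕ} (a ω p z₀ : ℝ)
    (Ξ : Fin N → ℝ → EuclideanSpace ℝ (Fin 3)) (j : Fin N)
    (hΞ : Ξ j = fun σ => (a * Real.cos (ω * σ)) • EuclideanSpace.single (0 : Fin 3) (1 : ℝ) +
      (a * Real.sin (ω * σ)) • EuclideanSpace.single (1 : Fin 3) (1 : ℝ) +
      (z₀ + p * σ) • EuclideanSpace.single (2 : Fin 3) (1 : ℝ))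
    (γ : Fin N → ℝ) (Γ α w₀ : ℝ)
    (heq : (∑ k : Fin N, (Γ * γ k / (4 * Real.pi)) • ∫ σ : ℝ,
        ((‖Ξ j 0 - Ξ k σ‖ ^ 2 + 1) ^ (3 / 2 : ℝ))⁻¹ • cross (deriv (Ξ k) σ) (Ξ j 0 - Ξ k σ)) +
        (1 / 2 : ℝ) • Ξ j 0 - α • cross (EuclideanSpace.single (2 : Fin 3) (1 : ℝ)) (Ξ j 0) =
        w₀ • deriv (Ξ j) 0) :
    ⟪EuclideanSpace.single (0 : Fin 3) (1 : ℝ), ∫ σ : ℝ,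
        ((‖Ξ j 0 - Ξ j σ‖ ^ 2 + 1) ^ (3 / 2 : ℝ))⁻¹ • cross (deriv (Ξ j) σ) (Ξ j 0 - Ξ j σ)⟫ = 0 ∧
    (∑ k : Fin N, ⟪EuclideanSpace.single (0 : Fin 3) (1 : ℝ), (Γ * γ k / (4 * Real.pi)) • ∫ σ : ℝ,
        ((‖Ξ j 0 - Ξ k σ‖ ^ 2 + 1) ^ (3 / 2 : ℝ))⁻¹ • cross (deriv (Ξ k) σ) (Ξ j 0 - Ξ k σ)⟫) =
      -(a / 2) := by
  refine ⟨inner_single_zero_integral_helix_eq_zero hΞ, ?_⟩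
  have key := congrArg (fun v => ⟪EuclideanSpace.single (0 : Fin 3) (1 : ℝ), v⟫) heq
  obtain ⟨h00, h01, h02⟩ := helix_apply hΞ 0
  obtain ⟨hd0, _, _⟩ := deriv_helix_apply hΞ 0
  simp only [inner_sub_right, inner_add_right, inner_sum, real_inner_smul_right,
    inner_single_zero_left, cross_apply_zero, single_two_apply_one, single_two_apply_two, h00, h01,
    hd0, Real.cos_zero, Real.sin_zero, mul_one, mul_zero, neg_zero, zero_mul, sub_zero]
    at key
  simp only [real_inner_smul_right, inner_single_zero_left]
  linarith

end Summit.NavierStokesRegularity.NavierStokesRegularity.Theorems.SkeletonEquilibrium.HelixExclusion
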